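import Literature.NumberTheory.EllipticCurves.ModularCurve
import Literature.NumberTheory.EllipticCurves.HeegnerPoints
import Literature.NumberTheory.EllipticCurves.ModularSymbols
import Literature.NumberTheory.EllipticCurves.Heights
import Literature.NumberTheory.EllipticCurves.AnalyticRank
import Literature.NumberTheory.EllipticCurves.RealPeriod
import Literature.NumberTheory.EllipticCurves.MordellWeil
import Literature.NumberTheory.EllipticCurves.Sha
import Literature.NumberTheory.DiophantineGeometry.Conductor
import HarnessLib

-- provenance: harness21/H21/H21/Statements/BSD/HeegnerPoints.lean @ 8c049bc (interim HEAD d8f2665); M5 mechanical rewrite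
/-!
# BSD: modular parametrisations, Heegner points and the Gross–Zagier formula

Family `bsd`, trunk T-ELLARITH (G16 `EllArithM`), outline item `BSDHeegnerStatements` (tier L).

## Statements

* **bsd.S37** (Birch 1975; Gross, *Heegner points on `X₀(N)`* (1984), §§1–3; Gross–Zagier,
  Invent. Math. 84 (1986), §I): the modular parametrisation `φ : X₀(N) → E`, its Manin constant
  `c` and modular degree `deg φ`; Heegner points `P_K ∈ E(K)` for imaginary quadratic `K`
  satisfying the Heegner hypothesis.

  - `Literature.NumberTheory.EllipticCurves.exists_modularParametrization` : every elliptic curve `E/ℚ` (globally minimal model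
    `W`, conductor `N`) admits modular parametrisation data at level `N` — modularity together
    with the integrality of the Manin constant, which is the *field* `c : ℤ` of
    `Literature.NumberTheory.EllipticCurves.ModularForms.ModularParametrizationData` (so there is no separate `c ∈ ℤ` statement);
  - `Literature.NumberTheory.EllipticCurves.modularDegree_pos` : `0 < deg φ`;
  - `Literature.NumberTheory.EllipticCurves.abs_maninConstant_eq_one_of_isSemistable'` : `|c| = 1` for the optimal
    parametrisation of a semistable curve (Mazur 1978; Abbes–Ullmo 1996; Česnavičius 2018);
  - `Literature.NumberTheory.EllipticCurves.heegnerPoint_mem` : under the Heegner hypothesis there is a Heegner point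
    `P_K ∈ E(K)`.
* **bsd.S16** (Gross–Zagier, Invent. Math. 84 (1986), Thm. I.6.3): `L'(E/K, 1)` is an explicit
  non-zero multiple of the Néron–Tate height of `P_K`.

  - `Literature.NumberTheory.EllipticCurves.grossZagierConstant`, `Literature.NumberTheory.EllipticCurves.grossZagierConstant_pos` : the explicit constant
    `‖ω‖² / (c² u² √|d_K|)` and its positivity;
  - `Literature.NumberTheory.EllipticCurves.gross_zagier'` : the formula, under the standing hypotheses of loc. cit. I.§3;
  - `Literature.NumberTheory.EllipticCurves.grossZagierFormula_iff` : unfolding of the `Prop` with the named constant;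
  - `Literature.NumberTheory.EllipticCurves.analyticRankEK`, `Literature.NumberTheory.EllipticCurves.one_le_analyticRankEK`,
    `Literature.NumberTheory.EllipticCurves.analyticRankEK_eq_one_iff_heegner_nonTorsion` : `ord_{s=1} L(E/K, s)`, it is `≥ 1`
    under the Heegner hypothesis, and it equals `1` iff `P_K` has infinite order.

## Design

* This is a statement file: all definitions of substance live in the accepted preludes
  `Literature.Prelude.EllArithM.ModularCurve` (item C17: `ModularParametrizationData`, `φ`,
  `maninConstant`, `modularDegree`, `nonempty_modularParametrizationData`,
  `abs_maninConstant_eq_one_of_isSemistable`) and `Literature.Prelude.EllArithM.HeegnerPoints` (item C18: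
  `IsImaginaryQuadratic`, `SatisfiesHeegnerHypothesis`, `HeegnerDatum`, `heegnerPointComplex`,
  `IsHeegnerPoint`, `LDerivEK`, `GrossZagierFormula`, `gross_zagier`, `exists_isHeegnerPoint`).
  The target statements here restate them at an explicit level `N` with the hypothesis
  `hN : W.conductorNorm ℤ = N` (OUTLINE §3), and are *proved* from the prelude results whenever
  the restatement is formal. `Literature/` is `sorry`-free (D-0014): the prelude results are named
  facts `def X : Prop`, so each restatement takes the corresponding fact as a hypothesis
  `(h : X …)`; the statements of this file without a formal proof
  (`isOfFinAddOrder_iff_of_isHeegnerPoint`, `analyticRankEK_eq_add`, `one_le_analyticRankEK`,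
  `analyticRankEK_eq_one_iff_LDerivEK_ne_zero`, `analyticRankEK_eq_one_iff_heegner_nonTorsion`)
  are themselves named facts `def … : Prop` (parameters `W N K` as displayed).
* No isogeny/CM import (OUTLINE C18, review 8): optimality of `W` in
  `abs_maninConstant_eq_one_of_isSemistable'` is expressed isogeny-free, as in the prelude, by
  minimality of `deg` among all parametrisation data at level `N` of all elliptic `W'/ℚ` with the
  same newform.
* `gross_zagier'` transcribes the standing assumption of Gross–Zagier 1986, I.§3 ("`D` odd", so
  that `D = d_K ≡ 1 (mod 4)` is squarefree; together with the Heegner hypothesis this is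
  `(D, 2N) = 1`) as the explicit hypothesis `Odd (NumberField.discr K)`; the prelude theorem
  `Literature.NumberTheory.EllipticCurves.gross_zagier` (citing also Yuan–Zhang–Zhang 2013, Thm. 1.2) has no parity assumption and
  implies the primed version.
* `analyticRankEK W K = ord_{s=1} L(E, s) L(E^{(d_K)}, s)` uses Mathlib's `analyticOrderNatAt`
  exactly like item G06 `WeierstrassCurve.analyticRank`, and the same product of entire
  `L`-functions as the prelude's `LDerivEK` (G06 `entireLFunction`, `quadraticTwist`).
* Mathlib search: `ZLattice.covolume` (with `covolume_pos`), `PeriodPair.lattice` (with its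
  `IsZLattice` instance), `NumberField.discr`, `NumberField.Units.torsionOrder`,
  `analyticOrderNatAt`, `IsOfFinAddOrder` exist and are used. Mathlib has no modular
  parametrisation, Manin constant, Heegner point or Gross–Zagier formula (searched `Heegner`,
  `Manin`, `GrossZagier`, `modularDegree`).

`noncomputable section`, `open scoped Classical`, `namespace Literature.BSD`.

## References

* B. J. Birch, *Heegner points of elliptic curves*, Symposia Mathematica XV (1975), 441–445.
* B. H. Gross, *Heegner points on `X₀(N)`*, in *Modular forms (Durham, 1983)*, Horwood (1984),
  87–105, §§1–5.
* B. H. Gross, D. B. Zagier, *Heegner points and derivatives of `L`-series*, Invent. Math. 84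
  (1986), 225–320, I.§3, Thm. I.6.3, V.§2.
* B. H. Gross, *Kolyvagin's work on modular elliptic curves*, LMS Lecture Notes 153 (1991), §2.
* X. Yuan, S.-W. Zhang, W. Zhang, *The Gross–Zagier formula on Shimura curves*, Ann. of Math.
  Studies 184 (2013), Thm. 1.2.
* B. Edixhoven, *On the Manin constants of modular elliptic curves*, Progr. Math. 89 (1991), Prop. 2.
* B. Mazur, Invent. Math. 44 (1978), Cor. 4.1; A. Abbes, E. Ullmo, Compositio Math. 103 (1996),
  Thm. A; K. Česnavičius, Compositio Math. 154 (2018), Thm. 1.2.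
* A. Wiles, Ann. of Math. 141 (1995); C. Breuil, B. Conrad, F. Diamond, R. Taylor, JAMS 14 (2001),
  Thm. A.
-/

noncomputable section

open scoped Classical

open NumberField Literature.NumberTheory.EllipticCurves.ModularForms

universe u

namespace Literature.NumberTheory.EllipticCurves

/-! ### bsd.S37: modular parametrisations, Manin constant, modular degree -/

section Parametrization

variable (W : WeierstrassCurve ℚ) (N : ℕ) [NeZero N]

/-- **bsd.S37** (modular parametrisation with integral Manin constant; Birch 1975; Gross 1984,
§§1–3; Gross–Zagier 1986, I.§4; modularity: Wiles 1995, Breuil–Conrad–Diamond–Taylor 2001, Thm. A;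
level `= N_E`: Carayol 1986; `c ∈ ℤ`: Edixhoven 1991, Prop. 2, composed with an isogeny of Néron
models). For every elliptic curve `E/ℚ`, given by a globally minimal model `W` of conductor
`N = N_E`, there is a modular parametrisation datum at level `N`: a newform
`f ∈ S₂(Γ₀(N))` with `aₙ(f) = aₙ(E)`, the Néron lattice `Λ_E` with the uniformisation
`ℂ/Λ_E ≃ E(ℂ)`, an **integer** Manin constant `c` with `c Λ_f ⊆ Λ_E` (i.e.
`φ^* ω_E = c · 2πi f(τ) dτ` for `φ(τ) = uniformize (c · 2πi ∫_{i∞}^τ f)`), and the modular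
degree `deg φ`. Restates `Literature.NumberTheory.EllipticCurves.ModularForms.nonempty_modularParametrizationData` at an explicit
level `N`. [cite: Birch1975] -/
theorem exists_modularParametrization [W.IsElliptic] [W.IsGloballyMinimal]
    (h : nonempty_modularParametrizationData) (hN : W.conductorNorm ℤ = N) :
    Nonempty (ModularParametrizationData W N) := by
  subst hN
  exact h W

/-- **bsd.S37** (modular degree; Zagier 1985, §1; Cremona 1997, §2.10). The modular degree
`deg φ` of a modular parametrisation `φ : X₀(N) → E` is a positive integer (`φ` is a finite
non-constant map of curves). Immediate from the field `deg_pos` of the datum. [cite: Zagier1985, §1] -/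
theorem modularDegree_pos (D : ModularParametrizationData W N) : 0 < D.modularDegree :=
  D.deg_pos

/-- **bsd.S37** (the Manin constant is a non-zero integer; Edixhoven 1991, §1 and Prop. 2). The
Manin constant `c` of a parametrisation datum is an integer by construction (the field
`c : ℤ`) and is non-zero. Restates `ModularParametrizationData.maninConstant_ne_zero`. [cite: Edixhoven1991, §1 and Prop. 2] -/
theorem maninConstant_ne_zero' (D : ModularParametrizationData W N) (h : D.maninConstant_ne_zero) :
    D.maninConstant ≠ 0 :=
  h

/-- **bsd.S37** (Manin constant of a semistable optimal curve; Mazur, Invent. Math. 44 (1978),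
Cor. 4.1; Abbes–Ullmo, Compositio Math. 103 (1996), Thm. A; Česnavičius, Compositio Math. 154
(2018), Thm. 1.2). Let `W/ℚ` be a globally minimal model of a semistable elliptic curve of
conductor `N`, and let `D` be a parametrisation datum at level `N` of minimal modular degree among
all parametrisation data at level `N` of all elliptic `W'/ℚ` with the same newform (i.e. `W` is
the `X₀(N)`-optimal curve of its isogeny class and `φ_D` its optimal parametrisation). Then
`c = ±1`. Manin's conjecture for non-semistable optimal curves is open and not asserted.
Restates `ModularParametrizationData.abs_maninConstant_eq_one_of_isSemistable` at an explicit
level `N = N_E`. [folklore] -/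
theorem abs_maninConstant_eq_one_of_isSemistable' [W.IsElliptic] [W.IsGloballyMinimal]
    (_hN : W.conductorNorm ℤ = N) (hst : W.IsSemistable ℤ) (D : ModularParametrizationData W N)
    (h : D.abs_maninConstant_eq_one_of_isSemistable)
    (hopt : ∀ (W' : WeierstrassCurve ℚ) [W'.IsElliptic] (D' : ModularParametrizationData W' N),
      D'.f = D.f → D.modularDegree ≤ D'.modularDegree) :
    |D.maninConstant| = 1 :=
  h hst hopt

/-- **bsd.S37** (period relation; Cremona 1997, §2.8 and §2.10; Edixhoven 1991, §1). For a
parametrisation datum `D` of the elliptic curve `W/ℚ`, `|c| · Ω⁺_f = m · Ω(W)` for a positive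
integer `m = [re Λ_E : c · re Λ_f]`, where `Ω(W) = W.realPeriodRat` (item G06) and
`Ω⁺_f = plusPeriod D.f` (item C9). Restates `ModularParametrizationData.realPeriodRat_dvd`. [cite: Cremona1997, §2.8 and §2.10] -/
theorem exists_mul_realPeriodRat_eq [W.IsElliptic] (D : ModularParametrizationData W N)
    (h : D.realPeriodRat_dvd) :
    ∃ m : ℕ, 0 < m ∧ (m : ℝ) * W.realPeriodRat = |(D.maninConstant : ℝ)| * plusPeriod D.f :=
  h

end Parametrization

/-! ### bsd.S37: Heegner points over `K` -/

section Heegner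

variable (W : WeierstrassCurve ℚ) (N : ℕ) [NeZero N] (K : Type u) [Field K] [NumberField K]

/-- **bsd.S37** (Heegner points are `K`-rational; Birch 1975; Gross 1984, §§3–4; Gross–Zagier
1986, I.§4). Let `E/ℚ` be an elliptic curve with globally minimal model `W` and conductor `N`, and
let `K` be an imaginary quadratic field satisfying the Heegner hypothesis for `N` (every `p ∣ N`
splits in `K`). Then there is a point `P_K ∈ E(K)` which is a Heegner point of level `N`: under
some embedding `K → ℂ` it maps to `∑_{[Q]} φ(τ_Q) = Tr_{H_K/K} φ((𝓞_K, 𝔫, [𝓞_K])) ∈ E(ℂ)`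
(`Literature.NumberTheory.EllipticCurves.IsHeegnerPoint`). Restates `Literature.NumberTheory.EllipticCurves.exists_isHeegnerPoint` at an explicit level. [cite: Birch1975] -/
theorem heegnerPoint_mem [W.IsElliptic] [W.IsGloballyMinimal] (h : exists_isHeegnerPoint W K)
    (hN : W.conductorNorm ℤ = N) (hK : IsImaginaryQuadratic K) (hH : SatisfiesHeegnerHypothesis N K) :
    ∃ P : (W.baseChange K).toAffine.Point, IsHeegnerPoint N W K P := by
  subst hN
  exact h hK hH

/-- Two Heegner points of level `N` in `E(K)` built from the same parametrisation datum differ by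
the action of `Gal(K/ℚ)`, sign and torsion; in particular any two Heegner points of level `N` in
`E(K)` are simultaneously of finite or of infinite order (Gross–Zagier 1986, I.(6.1) and V.§2;
Gross 1991, §2: `τ y_K = ε · ȳ_K + (torsion)`, and `φ' = α ∘ φ + Q` for two parametrisations
with the same newform, `α ∈ End(E) ⊗ ℚ` invertible). Named fact (D-0014). [cite: GrossZagier1986, I.(6.1) and V.§2] -/
def isOfFinAddOrder_iff_of_isHeegnerPoint : Prop :=
  ∀ [W.IsElliptic] {P P' : (W.baseChange K).toAffine.Point} (_hP : IsHeegnerPoint N W K P)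
    (_hP' : IsHeegnerPoint N W K P'), IsOfFinAddOrder P ↔ IsOfFinAddOrder P'

end Heegner

/-! ### bsd.S16: the Gross–Zagier formula -/

section GrossZagier

variable {W : WeierstrassCurve ℚ} {N : ℕ} [NeZero N]

/-- The **Gross–Zagier constant** `‖ω‖² / (c² · u² · √|d_K|)` of a parametrisation datum `Dt` and
an imaginary quadratic field `K`: `‖ω‖² = ∫_{E(ℂ)} |ω ∧ ω̄| = 2 · covol(Λ_E)` for
`Λ_E = Dt.L.lattice` (Mathlib `ZLattice.covolume`, Lebesgue measure on `ℂ`), `c = Dt.c` the Manin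
constant, `u = #𝓞_K^× / 2` (Mathlib `NumberField.Units.torsionOrder K / 2`) and
`d_K = NumberField.discr K`. This is literally the constant appearing in the prelude's
`Literature.NumberTheory.EllipticCurves.GrossZagierFormula` (Gross–Zagier 1986, Thm. I.6.3 with V.§2; Gross 1991, (1.1), citing
"[GZ; Ch. I, (6.5)]"). [cite: GrossZagier1986, Thm. I.6.3 with V.§2] -/
def grossZagierConstant (Dt : ModularParametrizationData W N) (K : Type u) [Field K]
    [NumberField K] : ℝ :=
  2 * ZLattice.covolume Dt.L.lattice /
    ((Dt.c : ℝ) ^ 2 * ((Units.torsionOrder K : ℝ) / 2) ^ 2 * √|(NumberField.discr K : ℝ)|)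

variable (W N) (K : Type u) [Field K] [NumberField K]

/-- The Gross–Zagier constant is positive: `covol(Λ_E) > 0` (Mathlib `ZLattice.covolume_pos`),
`c ≠ 0` (the named fact `ModularParametrizationData.maninConstant_ne_zero`, taken as hypothesis),
`#𝓞_K^× > 0` and `d_K ≠ 0` (Mathlib `NumberField.discr_ne_zero`). This is the "explicit
**non-zero** multiple" of bsd.S16 (Gross–Zagier 1986, Thm. I.6.3). [cite: GrossZagier1986, Thm. I.6.3] -/
theorem grossZagierConstant_pos (Dt : ModularParametrizationData W N) (hc : Dt.maninConstant_ne_zero) :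
    0 < grossZagierConstant Dt K := by
  unfold grossZagierConstant
  have hc0 : Dt.maninConstant ≠ 0 := hc
  have hc : (Dt.c : ℝ) ≠ 0 := by exact_mod_cast hc0
  have hu : (0 : ℝ) < Units.torsionOrder K := by exact_mod_cast Units.torsionOrder_pos K
  have hd : (0 : ℝ) < |(NumberField.discr K : ℝ)| :=
    abs_pos.mpr (by exact_mod_cast NumberField.discr_ne_zero K)
  have hcov : 0 < ZLattice.covolume Dt.L.lattice := ZLattice.covolume_pos _ _
  positivity

/-- Unfolding of the prelude `Prop` `Literature.GrossZagierFormula N W K` with the named constant: for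
every parametrisation datum `Dt`, Heegner datum `H` of discriminant `d_K`, embedding `ι : K → ℂ`
and `P ∈ E(K)` mapping to the Heegner point `∑_{[Q]} φ(τ_Q)`,
`L'(E/K, 1) = grossZagierConstant Dt K · ĥ(P)` (Gross–Zagier 1986, Thm. I.6.3). [cite: GrossZagier1986, Thm. I.6.3] -/
theorem grossZagierFormula_iff :
    GrossZagierFormula N W K ↔
      ∀ (Dt : ModularParametrizationData W N) (H : HeegnerDatum N (NumberField.discr K))
        (ι : K →+* ℂ) (P : (W.baseChange K).toAffine.Point),
        WeierstrassCurve.Affine.Point.map ι.toRatAlgHom P = heegnerPointComplex Dt H →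
          LDerivEK W K = ((grossZagierConstant Dt K * P.canonicalHeight : ℝ) : ℂ) :=
  Iff.rfl

/-- **bsd.S16** (Gross–Zagier formula; B. H. Gross, D. B. Zagier, *Heegner points and derivatives
of `L`-series*, Invent. Math. 84 (1986), Thm. I.6.3, in the elliptic-curve form of loc. cit. V.§2
and Gross 1991, (1.1)). Let `E/ℚ` be an elliptic curve (model `W`) of conductor `N`, and let `K`
be an imaginary quadratic field of discriminant `D = d_K` such that every prime `p ∣ N` splits in
`K` (Heegner hypothesis) and `D` is odd (standing assumptions of loc. cit. I.§3: then `D ≡ 1 (4)`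
is squarefree and `(D, 2N) = 1`). Then for the Heegner point `P_K ∈ E(K)`,

`L'(E/K, 1) = ‖ω‖² · ĥ(P_K) / (c² · u² · √|D|)`,

with `L(E/K, s) = L(E, s) L(E^{(D)}, s)`, `‖ω‖² = ∫_{E(ℂ)} |ω ∧ ω̄|`, `c` the Manin constant of the
parametrisation, `u = #𝓞_K^×/2` and `ĥ` the canonical height on `E` over `K` — the `Prop`
`Literature.GrossZagierFormula N W K`. Follows from the prelude fact `Literature.NumberTheory.EllipticCurves.gross_zagier` (hypothesis `h`),
which (after Yuan–Zhang–Zhang 2013, Thm. 1.2) needs neither the parity of `D` nor `N = N_E` as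
hypotheses. [cite: YuanZhangZhang2013, Thm. 1.2] -/
theorem gross_zagier' [W.IsElliptic] (h : gross_zagier N W K) (hK : IsImaginaryQuadratic K)
    (_hN : W.conductorNorm ℤ = N) (hH : SatisfiesHeegnerHypothesis N K)
    (_hD : Odd (NumberField.discr K)) : GrossZagierFormula N W K :=
  -- neither the parity assumption nor `N = N_E` is needed by the prelude fact
  h hK hH

/-- The **analytic rank of `E` over the quadratic field `K`**: the order of vanishing at `s = 1`
of `L(E/K, s) = L(E, s) · L(E^{(d_K)}, s)`, the product of the entire `L`-functions (item G06
`WeierstrassCurve.entireLFunction`) of `W` and of its quadratic twist by `d_K = NumberField.discr K`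
(item G06 `WeierstrassCurve.quadraticTwist`) — the same function whose derivative at `1` is the
prelude's `Literature.LDerivEK W K`. Defined through Mathlib's `analyticOrderNatAt` exactly like
`WeierstrassCurve.analyticRank` (junk value `0` if the product vanishes identically near `1`,
which never happens). Equals `r_an(E) + r_an(E^{(d_K)})` (Gross–Zagier 1986, I.§6–7; Gross 1984,
§5). [cite: GrossZagier1986, I.§6–7] -/
def analyticRankEK : ℕ :=
  analyticOrderNatAt (fun s ↦ W.entireLFunction s *
    (W.quadraticTwist (NumberField.discr K : ℚ)).entireLFunction s) 1

/-- `ord_{s=1} L(E/K, s) = r_an(E) + r_an(E^{(d_K)})`: orders of vanishing of entire functions add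
(both factors are entire and not identically zero, by modularity over `ℚ`, item G06
`WeierstrassCurve.hasEntireLFunction_rat`) (Gross–Zagier 1986, I.§7). Named fact (D-0014). [cite: GrossZagier1986, I.§7] -/
def analyticRankEK_eq_add : Prop :=
  ∀ [W.IsElliptic],
    analyticRankEK W K =
      W.analyticRank + (W.quadraticTwist (NumberField.discr K : ℚ)).analyticRank

/-- Under the Heegner hypothesis for the conductor `N = N_E` the functional equation of
`L(E/K, s)` has sign `−1` (the root numbers of `E` and `E^{(d_K)}` differ by
`χ_{d_K}(−N) = −1`), so `L(E/K, 1) = 0` and `ord_{s=1} L(E/K, s) ≥ 1` is odd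
(Gross 1984, §5; Gross–Zagier 1986, I.§7 and IV.§1). Named fact (D-0014). [cite: Gross1984, §5] -/
def one_le_analyticRankEK : Prop :=
  ∀ [W.IsElliptic] (_hK : IsImaginaryQuadratic K) (_hN : W.conductorNorm ℤ = N)
    (_hH : SatisfiesHeegnerHypothesis N K), 1 ≤ analyticRankEK W K

/-- `L'(E/K, 1) ≠ 0 ↔ ord_{s=1} L(E/K, s) = 1` under the Heegner hypothesis (where the order is
`≥ 1`, `one_le_analyticRankEK`): the first derivative at a zero of an analytic function is
non-zero iff the zero is simple (Gross–Zagier 1986, I.§7). Named fact (D-0014). [cite: GrossZagier1986, I.§7] -/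
def analyticRankEK_eq_one_iff_LDerivEK_ne_zero : Prop :=
  ∀ [W.IsElliptic] (_hK : IsImaginaryQuadratic K) (_hN : W.conductorNorm ℤ = N)
    (_hH : SatisfiesHeegnerHypothesis N K), analyticRankEK W K = 1 ↔ LDerivEK W K ≠ 0

/-- **bsd.S16** (corollary; Gross–Zagier 1986, Thm. I.6.3 with V.§2; Gross 1991, (1.1): "In
particular, the point `y_K` has infinite order if and only if `L'(E/K, 1) ≠ 0`"). Let `E/ℚ`
be an elliptic curve with globally minimal model `W` and conductor `N`, `K` an imaginary
quadratic field satisfying the Heegner hypothesis for `N`, and `P_K ∈ E(K)` a Heegner point of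
level `N`. Then `ord_{s=1} L(E/K, s) = 1` if and only if `P_K` has infinite order: by
Gross–Zagier `L'(E/K, 1) = (positive constant) · ĥ(P_K)` (`grossZagierConstant_pos`), and
`ĥ(P_K) = 0 ↔ P_K` torsion (item G06 `WeierstrassCurve.Affine.Point.canonicalHeight_eq_zero_iff`),
while `L(E/K, 1) = 0` (`one_le_analyticRankEK`). Named fact (D-0014); proved relative to `gross_zagier`
and `analyticRankEK_eq_one_iff_LDerivEK_ne_zero` as
`Literature.NumberTheory.EllipticCurves.analyticRankEK_eq_one_iff_heegner_nonTorsion_of` (`BSDHeegnerPointsGrossZagierProofs.lean`). [cite: GrossZagier1986, Thm. I.6.3 with V.§2] -/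
def analyticRankEK_eq_one_iff_heegner_nonTorsion : Prop :=
  ∀ [W.IsElliptic] [W.IsGloballyMinimal] (_hK : IsImaginaryQuadratic K) (_hN : W.conductorNorm ℤ = N)
    (_hH : SatisfiesHeegnerHypothesis N K) {P : (W.baseChange K).toAffine.Point}
    (_hP : IsHeegnerPoint N W K P), analyticRankEK W K = 1 ↔ ¬ IsOfFinAddOrder P

/-- **bsd.S16** with Kolyvagin (Gross–Zagier 1986, Thm. I.6.3; Kolyvagin 1990, Thm. A; Gross
1991, Thm. 1.3). If `ord_{s=1} L(E/K, s) = 1` for an imaginary quadratic `K` satisfying the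
Heegner hypothesis for `N = N_E`, then `rank E(K) = 1` and `Ш(E/K)` is finite (items G06
`WeierstrassCurve.mordellWeilRank`, `WeierstrassCurve.ShaFinite`). Proved from the named facts
`analyticRankEK_eq_one_iff_LDerivEK_ne_zero` and the prelude's
`Literature.NumberTheory.EllipticCurves.mordellWeilRank_eq_one_of_LDerivEK_ne_zero` (hypotheses `h₁`, `h₂`). [cite: GrossZagier1986, Thm. I.6.3] -/
theorem mordellWeilRank_eq_one_of_analyticRankEK_eq_one [W.IsElliptic] [W.IsGloballyMinimal]
    (h₁ : analyticRankEK_eq_one_iff_LDerivEK_ne_zero W N K)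
    (h₂ : mordellWeilRank_eq_one_of_LDerivEK_ne_zero W K)
    (hK : IsImaginaryQuadratic K) (hN : W.conductorNorm ℤ = N)
    (hH : SatisfiesHeegnerHypothesis N K) (hr : analyticRankEK W K = 1) :
    (W.baseChange K).mordellWeilRank = 1 ∧ (W.baseChange K).ShaFinite := by
  have hL := (h₁ hK hN hH).mp hr
  subst hN
  exact h₂ hK hH hL

end GrossZagier

end Literature.NumberTheory.EllipticCurves

end
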